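import Literature.Barriers.CriticalPhenomena.WeaklySAWTauIsomorphism
import Literature.Barriers.CriticalPhenomena.WeaklySAWTorusResolventComplex
import HarnessLib

/-!
# BBS 2015, Proposition 3.1 (supersymmetric representation of the weakly self-avoiding walk):
# `G_{N,g,ν}(0,b) = ∫ e^{-Σ_x(τ_{Δ,x} + gτ_x² + ντ_x)} φ̄_0 φ_b` on the torus, for `g > 0`, `ν > 0`

Fifth and final file of the series formalising Proposition 3.1 of Bauerschmidt–Brydges–Slade,
*Logarithmic correction for the susceptibility of the 4-dimensional weakly self-avoiding walk: a
renormalisation group analysis*, CMP 337 (2015), arXiv:1403.7422 — the supersymmetric integral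
representation of the continuous-time weakly self-avoiding walk two-point function on the discrete
torus `Λ = Λ_N = ℤ^d/L^Nℤ^d` (here `ℤ^d/nℤ^d`, any period `n ≥ 1`):

  `G_{N,ν}(a,b) = ∫ e^{-Σ_{x∈Λ}(τ_{Δ,x} + gτ_x² + ντ_x)} φ̄_a φ_b`     (source, (3.12); `a = 0` here,
  which is no loss by translation invariance).

Main result **`torusTwoPoint_eq_superIntegral`** (`g > 0`, `ν > 0`, `d` arbitrary, `n ≥ 1`):
`((torusTwoPoint d n g ν b).toReal : ℂ) = superIntegral (φ_bφ̄_0 · (e^{-S_{-Δ_Λ}} · e^{-Σ(gτ_x²+ντ_x)}))`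
with `torusTwoPoint` = `G_{N,ν}(0,b) = ∫₀^∞ E^Λ_0(e^{-gI(T)}𝟙_{X(T)=b}) e^{-νT} dT` of
`WeaklySAWFiniteVolume.lean` (source (1.4), (2.1)–(2.3)), `superIntegral`/`superGauss` of
`WeaklySAWSuperGaussian.lean` (`e^{-S_{-Δ}} = e^{-Σ_xτ_{Δ,x}}`, since `Σ_xτ_{Δ,x} = φ(-Δ)φ̄ + ψ(-Δ)ψ̄`,
source (3.11)) and `interactionForm` of `WeaklySAWTauIsomorphism.lean` (`e^{-Σ(gτ_x²+ντ_x)}`, source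
(3.4)–(3.5)). The proof is that of [BIS09] (Brydges–Imbrie–Slade 2009, Theorem 5.1 via Proposition
4.4), with the Fourier decomposition of `e^{-gΣt_x²}` taken Gaussian and site by site:

1. form side (`WeaklySAWTauIsomorphism.superIntegral_interaction_eq_integral_resolvent`, applicable as
   `Re φ(-Δ_Λ)φ̄ ≥ 0` — `re_quadForm_negLaplacianC_nonneg`):
   `∫ e^{-S_{-Δ}}e^{-Σ(gτ²+ντ)}φ̄_0φ_b = ∫_{ℝ^Λ}Π_xρ_g(w_x)·((-Δ+ν+iW)⁻¹)_{0b} dw`;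
2. resolvent expansion (`inv_negLaplacianC_add_diagonal_eq_tsum`, from
   `WeaklySAWTorusResolventComplex.lean`): `((-Δ+ν+iW)⁻¹)_{0b} = Σ_kΣ_{e}w_{ν+iw}(e)`, where along a
   `k`-step sequence `w_{ν+iw}(e) = 𝟙{ē(k)=b}Π_{i≤k}(2d+ν+iw_{ē(i)})⁻¹` (`stepSeqWeightC_fourierPotential`);
3. `∫dw ↔ Σ_k` (`integral_resolvent_eq_tsum`: `integral_tsum`, the layers dominated by
   `Π_xρ_g(w_x)·(T^{(ν)k}D_ν⁻¹)_{0b}`, summable — `norm_layer_le`, `summable_resolventTerm`);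
4. per skeleton (`integral_layer`, from `WeaklySAWSkeletonGaussFourier.integral_gaussDensity_mul_skelWeightN`):
   `∫Π_xρ_g(w_x)Π_i(2d+ν+iw_{ēᵢ})⁻¹dw = ∫_{(0,∞)^{k+1}}e^{-(2d+ν)Σσ-gΣ_xL_x(σ)²}dσ = skelIntegralN`;
5. walk side (`WeaklySAWSkeletonGaussFourier.torusTwoPoint_eq_tsum_stepSeq`):
   `G_{N,ν}(0,b) = Σ_kΣ_e𝟙{ē(k)=b}·skelIntegralN k ē (2d+ν) g`.

Also: `instLinearOrderTorusSite` (an enumeration order on `Λ`, fixing the orientation of the Grassmann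
basis; the super-integral carries the compensating sign `ε`), `negLaplacianC` (`-Δ_Λ` over `ℂ`),
`fourierPotential` (`ν + iw`). Scope: the source states Proposition 3.1 for `g > 0` and all `ν ∈ ℝ`
(both sides are entire in `ν` in finite volume); only `ν > 0` is proved here — the continuation to
`ν ≤ 0` is not carried out in this file. Everything is proved; no named facts.
-/

noncomputable section

open MeasureTheory Filter Topology Set Complex ComplexConjugate
open Literature.Probability.LatticeModels
open Literature.Probability.LatticeModels.SRW (StepSeq pos endpoint)
open Literature.MathematicalPhysics.QuantumLattice
open Literature.MathematicalPhysics.QuantumLattice.GrassmannAlgebra (berezin)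
open scoped BigOperators

namespace Literature.Barriers.CriticalPhenomena

namespace CTWSAW

variable {d n : ℕ}

/-! ### A linear order on the torus sites (orientation of the Grassmann basis) -/

/-- An (arbitrary, fixed) linear order on `Λ = ℤ^d/nℤ^d` (`n ≥ 1`), through an enumeration by
`Fin |Λ|`. It serves only to fix the orientation of the Grassmann monomial basis underlying `berezin`;
the super-integral `superIntegral` (coefficient of `Π_x ψ̄_xψ_x`, with the orientation sign `ε`) does
not depend on it. [folklore] -/
instance instLinearOrderTorusSite [NeZero n] : LinearOrder (TorusSite d n) :=
  LinearOrder.lift' (Fintype.equivFin (TorusSite d n)) (Fintype.equivFin (TorusSite d n)).injective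

/-! ### `-Δ_Λ` as a complex matrix and its positivity -/

/-- `-Δ_Λ` with complex entries: the complex Schrödinger matrix with zero potential.
[cite: BauerschmidtBrydgesSlade2015LogCorr, §3.3 (τ_{Δ,x} and the lattice Laplacian Δ on Λ)] -/
def negLaplacianC (d n : ℕ) : Matrix (TorusSite d n) (TorusSite d n) ℂ := schrodingerMatrixC d n 0

/-- `-Δ_Λ + v = -Δ_Λ + diag v` (bridging the `DecidableEq` instances silently through `Matrix.ext`).
[folklore] -/
theorem schrodingerMatrixC_eq_negLaplacianC_add [NeZero n] (v : TorusSite d n → ℂ) :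
    schrodingerMatrixC d n v = negLaplacianC d n + Matrix.diagonal v := by
  ext x y
  simp only [negLaplacianC, schrodingerMatrixC, Matrix.sub_apply, Matrix.add_apply, Matrix.diagonal_apply,
    Pi.zero_apply]
  split_ifs <;> ring

/-- **`-Δ_Λ` is positive semi-definite**: `Re φ(-Δ_Λ)φ̄ ≥ 0`
(`2dΣ|φ_x|² - Σ_xΣ_e φ_xφ̄_{x+ē}`, Cauchy–Schwarz and translation invariance of `Σ_x|φ_{x+ē}|²`).
[cite: BauerschmidtBrydgesSlade2015LogCorr, §3.3 (Σ_x τ_{Δ,x} = Σ_x φ_x(-Δφ̄)_x + ψ_x(-Δψ̄)_x, summation by parts)] -/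
theorem re_quadForm_negLaplacianC_nonneg [NeZero n] (φ : TorusSite d n → ℂ) :
    0 ≤ (Boson.quadForm (negLaplacianC d n) φ).re := by
  classical
  -- `φ(-Δ)φ̄ = Σ_x φ_x (2d φ̄_x - Σ_e φ̄_{x+ē})`
  have hgrad : ∀ x, Boson.gradPhi (negLaplacianC d n) φ x =
      2 * d * conj (φ x) - ∑ e : SRW.Dir d, conj (φ (x + torusStep n e)) := by
    intro x
    have h := torusStepMatrixC_mulVec (fun y => conj (φ y)) x
    simp only [Matrix.mulVec, dotProduct] at h
    simp only [Boson.gradPhi, negLaplacianC, schrodingerMatrixC, Matrix.sub_apply, Matrix.diagonal_apply,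
      Pi.zero_apply, add_zero, sub_mul, Finset.sum_sub_distrib, ite_mul, zero_mul]
    rw [Finset.sum_ite_eq Finset.univ x, if_pos (Finset.mem_univ _), h]
  rw [Boson.quadForm_eq_sum_gradPhi]
  simp_rw [hgrad, mul_sub, Finset.mul_sum]
  rw [Finset.sum_sub_distrib, Complex.sub_re, Complex.re_sum, Complex.re_sum]
  -- the diagonal part: `Re(φ_x · 2d φ̄_x) = 2d|φ_x|²`
  have hdiag : ∀ x, (φ x * (2 * d * conj (φ x))).re = 2 * d * ‖φ x‖ ^ 2 := by
    intro x
    rw [show φ x * (2 * d * conj (φ x)) = 2 * d * (φ x * conj (φ x)) by ring, Complex.mul_conj,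
      Complex.normSq_eq_norm_sq]
    rw [Complex.mul_re, Complex.ofReal_re, Complex.ofReal_im, mul_zero, sub_zero]
    simp
  simp_rw [hdiag]
  -- the hopping part: `Re(φ_x φ̄_{x+e}) ≤ (|φ_x|² + |φ_{x+e}|²)/2`, and `Σ_x |φ_{x+e}|² = Σ_x |φ_x|²`
  have hhop : ∀ x, (∑ e : SRW.Dir d, φ x * conj (φ (x + torusStep n e))).re ≤
      ∑ e : SRW.Dir d, (‖φ x‖ ^ 2 + ‖φ (x + torusStep n e)‖ ^ 2) / 2 := by
    intro x
    rw [Complex.re_sum]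
    refine Finset.sum_le_sum fun e _ => ?_
    calc (φ x * conj (φ (x + torusStep n e))).re ≤ ‖φ x * conj (φ (x + torusStep n e))‖ := Complex.re_le_norm _
      _ = ‖φ x‖ * ‖φ (x + torusStep n e)‖ := by rw [norm_mul, Complex.norm_conj]
      _ ≤ (‖φ x‖ ^ 2 + ‖φ (x + torusStep n e)‖ ^ 2) / 2 := by
          nlinarith [sq_nonneg (‖φ x‖ - ‖φ (x + torusStep n e)‖)]
  have hshift : ∀ e : SRW.Dir d, ∑ x, ‖φ (x + torusStep n e)‖ ^ 2 = ∑ x, ‖φ x‖ ^ 2 := fun e =>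
    Fintype.sum_equiv (Equiv.addRight (torusStep n e)) _ _ fun x => rfl
  have hsum : ∑ x, (∑ e : SRW.Dir d, φ x * conj (φ (x + torusStep n e))).re ≤ 2 * d * ∑ x, ‖φ x‖ ^ 2 := by
    calc ∑ x, (∑ e : SRW.Dir d, φ x * conj (φ (x + torusStep n e))).re
        ≤ ∑ x, ∑ e : SRW.Dir d, (‖φ x‖ ^ 2 + ‖φ (x + torusStep n e)‖ ^ 2) / 2 := Finset.sum_le_sum fun x _ => hhop x
      _ = ∑ e : SRW.Dir d, ∑ x, (‖φ x‖ ^ 2 + ‖φ (x + torusStep n e)‖ ^ 2) / 2 := Finset.sum_comm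
      _ = ∑ _e : SRW.Dir d, ∑ x, ‖φ x‖ ^ 2 := by
          refine Finset.sum_congr rfl fun e _ => ?_
          rw [← Finset.sum_div, Finset.sum_add_distrib, hshift e]; ring
      _ = 2 * d * ∑ x, ‖φ x‖ ^ 2 := by
          rw [Finset.sum_const, Finset.card_univ, SRW.card_dir, nsmul_eq_mul]; push_cast; ring
  rw [← Finset.mul_sum]
  linarith


/-! ### The Fourier killing potential `v_w = ν + iw` and the walk expansion of `(-Δ_Λ + v_w)⁻¹` -/

section Assembly

variable [NeZero n] {g ν : ℝ}

/-- The complex potential `v_w(y) = ν + iw_y` of the Gaussian–Fourier decomposition.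
[cite: BrydgesImbrieSlade2009, Proposition 4.4 (proof: the potential -iv_x + ε)] -/
def fourierPotential (ν : ℝ) (w : TorusSite d n → ℝ) : TorusSite d n → ℂ := fun y => (ν : ℂ) + I * w y

omit [NeZero n] in
/-- `Re v_w = ν`. [folklore] -/
theorem fourierPotential_re (ν : ℝ) (w : TorusSite d n → ℝ) (y : TorusSite d n) :
    (fourierPotential ν w y).re = ν := by
  simp [fourierPotential, Complex.add_re, Complex.mul_re]

/-- **`(-Δ_Λ + ν + iW)⁻¹_{0,b} = Σ_k Σ_e w_{v_w}(e)`** (the complex resolvent expansion of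
`WeaklySAWTorusResolventComplex.lean` along the Fourier potential; `ν > 0`).
[cite: BrydgesImbrieSlade2009, Theorem 2.4 with Proposition 4.4] -/
theorem inv_negLaplacianC_add_diagonal_eq_tsum (hν : 0 < ν) (w : TorusSite d n → ℝ) (b : TorusSite d n) :
    (negLaplacianC d n + Matrix.diagonal (fourierPotential ν w))⁻¹ 0 b =
      ∑' k, ∑ e : StepSeq d k, stepSeqWeightC n (fourierPotential ν w) b e := by
  rw [← schrodingerMatrixC_inv_apply_eq_tsum hν (fun y => (fourierPotential_re ν w y).ge) b,
    schrodingerMatrixC_eq_negLaplacianC_add]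

omit [NeZero n] in
/-- The walk weight along the Fourier potential is the killed skeleton weight of
`WeaklySAWSkeletonGaussFourier.lean`: `w_{v_w}(e) = 𝟙{ē(k)=b} Π_{i≤k}((2d+ν) + iw_{ē(i)})⁻¹`. [folklore] -/
theorem stepSeqWeightC_fourierPotential (ν : ℝ) (w : TorusSite d n → ℝ) (b : TorusSite d n) {k : ℕ}
    (e : StepSeq d k) :
    stepSeqWeightC n (fourierPotential ν w) b e = (if Torus.proj n (endpoint e) = b then 1 else 0) *
      skelWeightN k (fun i => Torus.proj n (pos e i)) (2 * d + ν) w := by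
  unfold stepSeqWeightC skelWeightN skelWeight fourierPotential
  rw [Fin.prod_univ_eq_prod_range (fun i => (((2 * d + ν : ℝ) : ℂ) + I * w (Torus.proj n (pos e i)))⁻¹) (k + 1)]
  congr 1
  refine Finset.prod_congr rfl fun i _ => ?_
  push_cast; ring

omit [NeZero n] in
/-- `w ↦ w_{v_w}(e)` is continuous. [folklore] -/
theorem continuous_stepSeqWeightC_fourierPotential (hν : 0 < ν) (b : TorusSite d n) {k : ℕ} (e : StepSeq d k) :
    Continuous fun w : TorusSite d n → ℝ => stepSeqWeightC n (fourierPotential ν w) b e := by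
  unfold stepSeqWeightC fourierPotential
  refine continuous_const.mul (continuous_finsetProd _ fun i _ => ?_)
  refine Continuous.inv₀ (by fun_prop) fun w => ?_
  have h := two_d_add_ne_zero (d := d) (n := n) (v := fun y => (ν : ℂ) + I * w y) (m := ν)
    (by positivity) (fun y => by simp [Complex.add_re, Complex.mul_re]) (Torus.proj n (pos e i))
  exact h

/-- `∫ ρ_g = 1` (as a complex integral of the real density). [folklore] -/
theorem integral_gaussDensity_complex (hg : 0 < g) : ∫ w : ℝ, (gaussDensity g w : ℂ) = 1 := by
  have h := integral_gaussDensity_mul_cexp hg 0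
  simp only [Complex.ofReal_zero, mul_zero, Complex.exp_zero, mul_one] at h
  rw [h]; simp

/-- `∫_{ℝ^Λ} Π_x ρ_g(w_x) dw = 1`. [folklore] -/
theorem integral_prod_gaussDensity_complex (hg : 0 < g) :
    ∫ w : TorusSite d n → ℝ, ∏ x, (gaussDensity g (w x) : ℂ) = 1 := by
  rw [volume_pi, integral_fintype_prod_eq_prod (𝕜 := ℂ) (f := fun (_ : TorusSite d n) (t : ℝ) => (gaussDensity g t : ℂ))]
  simp [integral_gaussDensity_complex hg]

/-- `Π_x ρ_g(w_x)` (complex) is integrable on `ℝ^Λ`. [folklore] -/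
theorem integrable_prod_gaussDensity_complex (hg : 0 < g) :
    Integrable fun w : TorusSite d n → ℝ => ∏ x, (gaussDensity g (w x) : ℂ) := by
  have := Integrable.fintype_prod (𝕜 := ℂ) (μ := fun _ : TorusSite d n => (volume : Measure ℝ))
    (f := fun (_ : TorusSite d n) (t : ℝ) => (gaussDensity g t : ℂ)) fun _ => (integrable_gaussDensity hg).ofReal
  rw [← volume_pi] at this; exact this

/-- The norm of `Π_x ρ_g(w_x)`. [folklore] -/
theorem norm_prod_gaussDensity (hg : 0 < g) (w : TorusSite d n → ℝ) :
    ‖∏ x, (gaussDensity g (w x) : ℂ)‖ = ∏ x, gaussDensity g (w x) := by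
  rw [norm_prod]
  exact Finset.prod_congr rfl fun x _ => by rw [Complex.norm_real, Real.norm_eq_abs, abs_of_pos (gaussDensity_pos hg _)]

/-- **The `k`-jump layer, integrated against `ρ_g^{⊗Λ}`**:
`∫ Π_xρ_g(w_x) Σ_{e} w_{v_w}(e) dw = Σ_e 𝟙{ē(k)=b}·skelIntegralN k ē (2d+ν) g` (the per-skeleton identity
of `WeaklySAWSkeletonGaussFourier.lean`, finite sum). [cite: BrydgesImbrieSlade2009, Proposition 4.4 (proof)] -/
theorem integral_layer (hg : 0 < g) (hν : 0 < ν) (b : TorusSite d n) (k : ℕ) :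
    ∫ w : TorusSite d n → ℝ, (∏ x, (gaussDensity g (w x) : ℂ)) *
        ∑ e : StepSeq d k, stepSeqWeightC n (fourierPotential ν w) b e =
      ∑ e : StepSeq d k, ((((if Torus.proj n (endpoint e) = b then (1 : ℝ) else 0) *
        skelIntegralN k (fun i => Torus.proj n (pos e i)) (2 * d + ν) g : ℝ)) : ℂ) := by
  have ha : 0 < 2 * (d : ℝ) + ν := by positivity
  have hint : ∀ e : StepSeq d k, Integrable fun w : TorusSite d n → ℝ =>
      (∏ x, (gaussDensity g (w x) : ℂ)) * stepSeqWeightC n (fourierPotential ν w) b e := by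
    intro e
    refine ((integrable_prod_gaussDensity_complex hg).norm.mul_const ((2 * d + ν)⁻¹ ^ (k + 1))).mono'
      ((integrable_prod_gaussDensity_complex hg).1.mul
        (continuous_stepSeqWeightC_fourierPotential hν b e).aestronglyMeasurable)
      (Eventually.of_forall fun w => ?_)
    rw [norm_mul]
    refine mul_le_mul_of_nonneg_left ?_ (norm_nonneg _)
    refine (norm_stepSeqWeightC_le ha (fun y => (fourierPotential_re ν w y).ge) b e).trans ?_
    have h1 : (∏ i ∈ Finset.range (k + 1), (2 * (d : ℝ) + (fun _ => ν) (Torus.proj n (pos e i)))⁻¹) =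
        (2 * d + ν)⁻¹ ^ (k + 1) := by
      rw [Finset.prod_const, Finset.card_range]
    rw [h1]
    split_ifs
    · simp
    · simp only [zero_mul]; positivity
  simp_rw [Finset.mul_sum]
  rw [integral_finsetSum _ fun e _ => hint e]
  refine Finset.sum_congr rfl fun e _ => ?_
  simp_rw [stepSeqWeightC_fourierPotential]
  have hcomm : ∀ w : TorusSite d n → ℝ, (∏ x, (gaussDensity g (w x) : ℂ)) *
      ((if Torus.proj n (endpoint e) = b then (1 : ℂ) else 0) *
        skelWeightN k (fun i => Torus.proj n (pos e i)) (2 * d + ν) w) =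
      (if Torus.proj n (endpoint e) = b then (1 : ℂ) else 0) *
        ((∏ x, (gaussDensity g (w x) : ℂ)) * skelWeightN k (fun i => Torus.proj n (pos e i)) (2 * d + ν) w) := by
    intro w; ring
  simp_rw [hcomm]
  rw [integral_const_mul, integral_gaussDensity_mul_skelWeightN hg ha]
  push_cast
  split_ifs <;> simp

/-- The layers are dominated: `‖Π_xρ_g(w_x) Σ_e w_{v_w}(e)‖ ≤ Π_xρ_g(w_x) · (T^{(ν)k}D_ν⁻¹)_{0,b}`. [folklore] -/
theorem norm_layer_le (hg : 0 < g) (hν : 0 < ν) (b : TorusSite d n) (k : ℕ) (w : TorusSite d n → ℝ) :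
    ‖(∏ x, (gaussDensity g (w x) : ℂ)) * ∑ e : StepSeq d k, stepSeqWeightC n (fourierPotential ν w) b e‖ ≤
      (∏ x, gaussDensity g (w x)) * resolventTerm (fun _ => ν) k 0 b := by
  rw [norm_mul, norm_prod_gaussDensity hg]
  refine mul_le_mul_of_nonneg_left ?_ (Finset.prod_nonneg fun x _ => (gaussDensity_pos hg _).le)
  refine (norm_sum_le _ _).trans ?_
  exact sum_norm_stepSeqWeightC_le (by positivity) (fun y => (fourierPotential_re ν w y).ge) b k

/-- **Interchanging the `w`-integral with the walk expansion**:
`∫ Π_xρ_g(w_x) Σ_k Σ_e w_{v_w}(e) dw = Σ_k Σ_e 𝟙{ē(k)=b}·skelIntegralN k ē (2d+ν) g` (`integral_tsum`,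
dominated by the real resolvent series `Σ_k (T^{(ν)k}D_ν⁻¹)_{0,b} < ∞`). [cite: BrydgesImbrieSlade2009, Proposition 4.4 (proof: "further application of Fubini's theorem")] -/
theorem integral_resolvent_eq_tsum (hg : 0 < g) (hν : 0 < ν) (b : TorusSite d n) :
    ∫ w : TorusSite d n → ℝ, (∏ x, (gaussDensity g (w x) : ℂ)) *
        (negLaplacianC d n + Matrix.diagonal (fourierPotential ν w))⁻¹ 0 b =
      ∑' k, ∑ e : StepSeq d k, ((((if Torus.proj n (endpoint e) = b then (1 : ℝ) else 0) *
        skelIntegralN k (fun i => Torus.proj n (pos e i)) (2 * d + ν) g : ℝ)) : ℂ) := by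
  have ha : 0 < 2 * (d : ℝ) + ν := by positivity
  set F : ℕ → (TorusSite d n → ℝ) → ℂ := fun k w =>
    (∏ x, (gaussDensity g (w x) : ℂ)) * ∑ e : StepSeq d k, stepSeqWeightC n (fourierPotential ν w) b e with hF
  -- rewrite the integrand as `Σ' k F k w`
  have hsum : ∀ w : TorusSite d n → ℝ, (∏ x, (gaussDensity g (w x) : ℂ)) *
      (negLaplacianC d n + Matrix.diagonal (fourierPotential ν w))⁻¹ 0 b = ∑' k, F k w := by
    intro w
    rw [inv_negLaplacianC_add_diagonal_eq_tsum hν w b, hF]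
    simp only
    rw [← tsum_mul_left]
  simp_rw [hsum]
  have hmeas : ∀ k, AEStronglyMeasurable (F k) volume := fun k => by
    have : Continuous (F k) := by
      rw [hF]
      refine Continuous.mul ?_ (continuous_finsetSum _ fun e _ =>
        continuous_stepSeqWeightC_fourierPotential hν b e)
      exact continuous_finsetProd _ fun x _ => Complex.continuous_ofReal.comp
        ((continuous_gaussDensity g).comp (continuous_apply x))
    exact this.aestronglyMeasurable
  -- the `L¹` bounds
  have hlin : ∫⁻ w : TorusSite d n → ℝ, ENNReal.ofReal (∏ x, gaussDensity g (w x)) = 1 := by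
    have hnn : 0 ≤ᵐ[volume] fun w : TorusSite d n → ℝ => ∏ x, gaussDensity g (w x) :=
      Eventually.of_forall fun w => Finset.prod_nonneg fun x _ => (gaussDensity_pos hg _).le
    have hint : Integrable fun w : TorusSite d n → ℝ => ∏ x, gaussDensity g (w x) := by
      have := Integrable.fintype_prod (𝕜 := ℝ) (μ := fun _ : TorusSite d n => (volume : Measure ℝ))
        (f := fun (_ : TorusSite d n) (t : ℝ) => gaussDensity g t) fun _ => integrable_gaussDensity hg
      rw [← volume_pi] at this; exact this
    rw [← ofReal_integral_eq_lintegral_ofReal hint hnn]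
    have h1 : ∫ w : TorusSite d n → ℝ, ∏ x, gaussDensity g (w x) = 1 := by
      have h := integral_prod_gaussDensity_complex (d := d) (n := n) hg
      rw [show (fun w : TorusSite d n → ℝ => ∏ x, (gaussDensity g (w x) : ℂ)) =
          fun w => (((∏ x, gaussDensity g (w x) : ℝ)) : ℂ) from funext fun w => (Complex.ofReal_prod _ _).symm,
        integral_complex_ofReal] at h
      exact_mod_cast h
    rw [h1, ENNReal.ofReal_one]
  have hbound : ∀ k, ∫⁻ w, ‖F k w‖ₑ ≤ ENNReal.ofReal (resolventTerm (fun _ => ν) k 0 b) := by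
    intro k
    calc ∫⁻ w, ‖F k w‖ₑ ≤ ∫⁻ w : TorusSite d n → ℝ, ENNReal.ofReal ((∏ x, gaussDensity g (w x)) *
          resolventTerm (fun _ => ν) k 0 b) := by
          refine lintegral_mono fun w => ?_
          rw [← ofReal_norm]
          exact ENNReal.ofReal_le_ofReal (norm_layer_le hg hν b k w)
      _ = (∫⁻ w : TorusSite d n → ℝ, ENNReal.ofReal (∏ x, gaussDensity g (w x))) *
          ENNReal.ofReal (resolventTerm (fun _ => ν) k 0 b) := by
          rw [← lintegral_mul_const' _ _ ENNReal.ofReal_ne_top]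
          refine lintegral_congr fun w => ?_
          rw [ENNReal.ofReal_mul (Finset.prod_nonneg fun x _ => (gaussDensity_pos hg _).le)]
      _ = ENNReal.ofReal (resolventTerm (fun _ => ν) k 0 b) := by rw [hlin, one_mul]
  have hne : ∑' k, ∫⁻ w, ‖F k w‖ₑ ≠ ⊤ := by
    refine ne_top_of_le_ne_top ?_ (ENNReal.tsum_le_tsum hbound)
    rw [← ENNReal.ofReal_tsum_of_nonneg (fun k => resolventTerm_nonneg (fun _ => ha) k 0 b)
      (summable_resolventTerm hν (fun _ => le_rfl) 0 b)]
    exact ENNReal.ofReal_ne_top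
  rw [integral_tsum hmeas hne]
  exact tsum_congr fun k => integral_layer hg hν b k

/-- **Proposition 3.1 of Bauerschmidt–Brydges–Slade 2015 (for `g > 0`, `ν > 0`)** — the supersymmetric
integral representation of the two-point function of the continuous-time weakly self-avoiding walk on
the torus `Λ = ℤ^d/nℤ^d`:
`G_{N,ν}(0,b) = ∫ e^{-Σ_x(τ_{Δ,x} + gτ_x² + ντ_x)} φ̄_0 φ_b`,
with the left side the `G_{N,ν}` of `WeaklySAWFiniteVolume.lean` (`∫₀^∞ E^Λ_0(e^{-gI(T)}𝟙_{X(T)=b})e^{-νT}dT`,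
a finite non-negative real) and the right side the super-integral of the forms of
`WeaklySAWSuperGaussian.lean` / `WeaklySAWTauIsomorphism.lean`: `e^{-Στ_{Δ,x}} = e^{-S_{-Δ_Λ}}`
(`superGauss (negLaplacianC d n)`; `Σ_xτ_{Δ,x} = φ(-Δ)φ̄ + ψ(-Δ)ψ̄` by summation by parts, eq. (3.11)) and
`e^{-Σ(gτ_x²+ντ_x)} = interactionForm g ν`. Proof as in [BIS09]: Gaussian–Fourier decomposition of the
interaction site by site, `∫e^{-S_{-Δ+ν+iW}}φ̄_0φ_b = (-Δ+ν+iW)⁻¹_{0b}` (self-normalised super-Gaussian),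
resolvent expansion over walks, Fubini, and the per-skeleton identity back to the local-time weights.
(The source states the identity for all real `ν` when `g > 0`; the extension from `ν > 0` is an analytic
continuation in `ν` not carried out here.)
[cite: BauerschmidtBrydgesSlade2015LogCorr, Proposition 3.1]
[cite: BrydgesImbrieSlade2009, Theorem 5.1 and Proposition 4.4] -/
theorem torusTwoPoint_eq_superIntegral (hg : 0 < g) (hν : 0 < ν) (b : TorusSite d n) :
    (((torusTwoPoint d n g ν b).toReal : ℝ) : ℂ) =
      superIntegral (ofFun (fun φ => φ b * conj (φ 0)) *
        (superGauss (negLaplacianC d n) * interactionForm g ν)) := by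
  have ha : 0 < 2 * (d : ℝ) + ν := by positivity
  -- walk side: `G_{N,ν}(0,b) = Σ_k Σ_e 𝟙 skelIntegralN` as a real series, cast to `ℂ`
  have hwalk : (((torusTwoPoint d n g ν b).toReal : ℝ) : ℂ) =
      ∑' k, ∑ e : StepSeq d k, ((((if Torus.proj n (endpoint e) = b then (1 : ℝ) else 0) *
        skelIntegralN k (fun i => Torus.proj n (pos e i)) (2 * d + ν) g : ℝ)) : ℂ) := by
    rw [torusTwoPoint_eq_tsum_stepSeq hg.le ha b, ENNReal.tsum_toReal_eq fun k => ?_]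
    · rw [Complex.ofReal_tsum]
      refine tsum_congr fun k => ?_
      rw [ENNReal.toReal_sum fun e _ => ENNReal.ofReal_ne_top, Complex.ofReal_sum]
      refine Finset.sum_congr rfl fun e _ => ?_
      rw [ENNReal.toReal_ofReal]
      exact mul_nonneg (by split_ifs <;> norm_num) (skelIntegralN_nonneg _ _ _ _)
    · exact ENNReal.sum_ne_top.2 fun e _ => ENNReal.ofReal_ne_top
  -- Fourier side
  have key : (((torusTwoPoint d n g ν b).toReal : ℝ) : ℂ) =
      ∫ w : TorusSite d n → ℝ, (∏ x, (gaussDensity g (w x) : ℂ)) *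
        (negLaplacianC d n + Matrix.diagonal (fourierPotential ν w))⁻¹ 0 b := by
    rw [integral_resolvent_eq_tsum hg hν b, hwalk]
  -- form side (the `DecidableEq` instances behind `Matrix.diagonal` are reconciled by `convert`)
  rw [superIntegral_interaction_eq_integral_resolvent re_quadForm_negLaplacianC_nonneg hg hν 0 b, key]
  refine integral_congr_ae (Eventually.of_forall fun w => ?_)
  -- the integrands agree: same matrix, `DecidableEq` instances reconciled by `Subsingleton.elim`
  dsimp only
  congr! (config := { closePre := false, closePost := false })
  all_goals first | exact Subsingleton.elim _ _ | rfl

end Assembly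

end CTWSAW

end Literature.Barriers.CriticalPhenomena
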